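import Mathlib
import HarnessLib
import Summits.AtomisticToContinuum.Crystallization.Theorems.PricedLinkCensusSoftFourRingsRigPairs

/-!
# Soft four-rings certified numerics, PAIR-TARGET extension (2): replay soundness and the wrapper
# (decomp-a2c, lens 3, gen 32 — the `P`-route engine for `CapForcing (1/100)`)

Sequel of `…RigPairs`.  `runInstrsT_sound` / `runCellT_sound`: a passing pair-target replay leaves
NO feasible configuration in the cell satisfying the negated goals (strong induction on the stream,
verbatim the discipline of `Rig.runInstrs_sound`, with `CloseTo ↦ False` and no `objective`).
`infeasible_of_checkAllT`: the wrapper to twelve unit vectors `p : Fin 12 → ℝ³` in the one-percent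
windows (frame normal form `Rig.coords`, chart cover `Rig.coversChart_sound`, as in
`Rig.close_of_checkAll`), and its one-target form `inner_lt_of_checkAllT`:
`checkAllT m [(a, b, C)] cells = true ⟹ ⟪p a, p b⟫ < C / S²`; `inner_lt_of_checkAllT_relabel`
transports it along a bond automorphism `σ` of the model (so one certified representative per
orbit of labelled pairs suffices).
`[folklore]`; no `sorry`; no `instance`/`notation`; no data.
-/

namespace Summit.AtomisticToContinuum.Crystallization.Theorems

namespace Rig

open Literature.Analysis.ValidatedNumerics.NumericsMP
open scoped Matrix RealInnerProductSpace

/-! ### Replay induction -/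

/-- **Soundness of the pair-target replay**: if `runInstrsT` accepts, no configuration in the boxes
is feasible with the negated goals. -/
theorem runInstrsT_sound {m : Model} (hW : m.WF) {T : List PairTarget} {x : Fin 12 → Fin 3 → ℝ}
    (hF : Feasible m.bond x) (hT : TargetsHold T x) :
    ∀ (n : ℕ) (is : List Instr), is.length ≤ n → ∀ (bx : Boxes) (st : List Step), bx.mem x →
      StepsOK m st → runInstrsT m T bx st is = true → False := by
  intro n
  induction n with
  | zero =>
    intro is hlen bx st _ _ h
    have : is = [] := List.eq_nil_of_length_eq_zero (Nat.le_zero.1 hlen)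
    subst this; simp [runInstrsT] at h
  | succ n ih =>
    intro is hlen bx st hx hst h
    cases is with
    | nil => simp [runInstrsT] at h
    | cons i is =>
      have hlen' : is.length ≤ n := by simp at hlen; omega
      cases i with
      | place terms k =>
        rw [runInstrsT] at h
        revert h
        cases hpb : placeBoxes bx st with
        | none => simp
        | some r =>
          obtain ⟨v, main, alt, rest⟩ := r
          intro h
          simp only [Bool.and_eq_true] at h
          obtain ⟨halt, hmain⟩ := h
          obtain ⟨hcases, hrest⟩ := placeBoxes_sound hW hF hx hst hpb
          rcases hcases with hm | ha
          · exact ih (is.drop k) (le_trans (by rw [List.length_drop]; omega) hlen') _ rest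
              (mem_update hx v hm) hrest hmain
          · have hxAlt := mem_update hx v ha
            by_cases hci : certInfeasible (Function.update bx v (some alt))
                (rowsOfT m.bond T (Function.update bx v (some alt))).toArray terms = true
            · exact absurd (pruneT_sound hF hT hxAlt terms) (by rw [hci]; simp)
            · rw [if_neg hci] at halt
              exact ih (is.take k) (le_trans (by rw [List.length_take]; omega) hlen') _ rest hxAlt
                hrest halt
      | bound v k up cert =>
        simp only [runInstrsT, stepInstrT] at h
        obtain ⟨hnp, hrun⟩ := applyBoundT_sound hF hT hx st v k up cert
        have hnv := applyBoundT_ne_verified m T bx st v k up cert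
        revert h
        cases hab : applyBoundT m T bx st v k up cert with
        | pruned => exact absurd hab hnp
        | verified => exact absurd hab hnv
        | failed => simp
        | running bx' st' =>
          intro h
          obtain ⟨hx', hst'⟩ := hrun bx' st' hab
          exact ih is hlen' bx' st' hx' (by rw [hst']; exact hst) h
      | prune terms =>
        simp only [runInstrsT, stepInstrT, pruneT_sound hF hT hx terms] at h
        simp at h
      | objective qw qx qy qz refl certs =>
        simp [runInstrsT, stepInstrT] at h

/-- **Soundness of the pair-target cell checker.** -/
theorem runCellT_sound {m : Model} (hW : m.WF) {T : List PairTarget} {c : Cell}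
    (h : runCellT m T c = true) {x : Fin 12 → Fin 3 → ℝ} (hF : Feasible m.bond x)
    (hT : TargetsHold T x) (hc : InCell m c x) : False := by
  obtain ⟨hnn, hmem⟩ := initBoxes_sound hW hF hc
  unfold runCellT at h
  revert h
  cases hib : initBoxes m c with
  | none => simp
  | some ob =>
    cases ob with
    | none => exact absurd hib hnn
    | some bx =>
      intro h
      exact runInstrsT_sound hW hF hT c.instrs.length c.instrs le_rfl bx m.steps (hmem bx hib)
        (stepsOK_of_WF hW) h

/-! ### The wrapper to twelve unit vectors -/

/-- **No twelve unit vectors in the one-percent windows satisfy the negated goals** of a passing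
pair-target check (frame normal form and chart cover as in `close_of_checkAll`). -/
theorem infeasible_of_checkAllT {m : Model} (hW : m.WF) {T : List PairTarget} {cells : List Cell}
    (hchk : checkAllT m T cells = true) (p : Fin 12 → EuclideanSpace ℝ (Fin 3))
    (hp1 : ∀ i, ‖p i‖ = 1) (hall : ∀ i j, i ≠ j → ⟪p i, p j⟫ ≤ chiR)
    (hbond : ∀ i j, i ≠ j → m.bond i j = true → cbloR ≤ ⟪p i, p j⟫)
    (hnb : ∀ i j, i ≠ j → m.bond i j = false → ⟪p i, p j⟫ ≤ cnbR)
    (hT : ∀ t ∈ T, (t.C : ℝ) ≤ (SC : ℝ) * SC * ⟪p t.a, p t.b⟫) : False := by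
  unfold checkAllT at hchk
  simp only [Bool.and_eq_true, List.all_eq_true] at hchk
  obtain ⟨⟨hcovT, hcovF⟩, hall'⟩ := hchk
  have hon := frame_orthonormal hW hp1 hall hbond
  have hF : Feasible m.bond (coords m p) := feasible_coords hW hp1 hall hbond hnb
  have hTX : TargetsHold T (coords m p) := by
    intro t ht; rw [coords_dot hon]; exact hT t ht
  obtain ⟨hX0, hX1y, hX1x, hX2y⟩ := coords_frame_pts hW hp1 hall hbond
  have hy := abs_coords_le_one hp1 hon m.free 1
  rw [abs_le] at hy
  have key : ∀ xp : Bool, coversChart cells xp = true →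
      (if xp then 0 ≤ coords m p m.free 0 else coords m p m.free 0 ≤ 0) → False := by
    intro xp hcov hsign
    obtain ⟨c, hc, hcx, htlo, hthi⟩ := coversChart_sound hcov (coords m p m.free 1) hy.1 hy.2
    have hcell : runCellT m T c = true := hall' c hc
    have hIn : InCell m c (coords m p) := ⟨hX0, hX1y, hX1x, hX2y, htlo, hthi, by rw [hcx]; exact hsign⟩
    exact runCellT_sound hW hcell hF hTX hIn
  rcases le_or_gt 0 (coords m p m.free 0) with h0 | h0
  · exact key true hcovT (by simpa using h0)
  · exact key false hcovF (by simpa using h0.le)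

/-- **One target**: a passing check of `[(a, b, C)]` certifies `⟪p a, p b⟫ < C / S²` for every twelve
unit vectors in the one-percent windows of the model. -/
theorem inner_lt_of_checkAllT {m : Model} (hW : m.WF) {a b : Fin 12} {C : ℤ} {cells : List Cell}
    (hchk : checkAllT m [⟨a, b, C⟩] cells = true) (p : Fin 12 → EuclideanSpace ℝ (Fin 3))
    (hp1 : ∀ i, ‖p i‖ = 1) (hall : ∀ i j, i ≠ j → ⟪p i, p j⟫ ≤ chiR)
    (hbond : ∀ i j, i ≠ j → m.bond i j = true → cbloR ≤ ⟪p i, p j⟫)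
    (hnb : ∀ i j, i ≠ j → m.bond i j = false → ⟪p i, p j⟫ ≤ cnbR) :
    ⟪p a, p b⟫ < (C : ℝ) / ((SC : ℝ) * SC) := by
  have hS : (0 : ℝ) < SC := by exact_mod_cast SC_pos
  have hS2 : (0 : ℝ) < (SC : ℝ) * SC := mul_pos hS hS
  by_contra hge
  rw [not_lt, div_le_iff₀ hS2] at hge
  refine infeasible_of_checkAllT hW hchk p hp1 hall hbond hnb ?_
  intro t ht
  simp only [List.mem_cons, List.mem_nil_iff, or_false] at ht
  subst ht
  simp only
  linarith

/-- **Relabelling**: the one-target conclusion transported along an injective bond-preserving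
relabelling `σ` (the hypotheses on `p` are invariant, so `p ∘ σ` qualifies). -/
theorem inner_lt_of_checkAllT_relabel {m : Model} (hW : m.WF) {a b : Fin 12} {C : ℤ}
    {cells : List Cell} (hchk : checkAllT m [⟨a, b, C⟩] cells = true) {σ : Fin 12 → Fin 12}
    (hσ : Function.Injective σ) (hσb : ∀ i j, m.bond (σ i) (σ j) = m.bond i j)
    (p : Fin 12 → EuclideanSpace ℝ (Fin 3)) (hp1 : ∀ i, ‖p i‖ = 1)
    (hall : ∀ i j, i ≠ j → ⟪p i, p j⟫ ≤ chiR)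
    (hbond : ∀ i j, i ≠ j → m.bond i j = true → cbloR ≤ ⟪p i, p j⟫)
    (hnb : ∀ i j, i ≠ j → m.bond i j = false → ⟪p i, p j⟫ ≤ cnbR) :
    ⟪p (σ a), p (σ b)⟫ < (C : ℝ) / ((SC : ℝ) * SC) :=
  inner_lt_of_checkAllT hW hchk (fun i => p (σ i)) (fun i => hp1 _)
    (fun i j hij => hall _ _ (hσ.ne hij))
    (fun i j hij hb => hbond _ _ (hσ.ne hij) (by rw [hσb]; exact hb))
    (fun i j hij hb => hnb _ _ (hσ.ne hij) (by rw [hσb]; exact hb))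

end Rig

end Summit.AtomisticToContinuum.Crystallization.Theorems
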